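import Summits.BirchSwinnertonDyer.BirchSwinnertonDyer.Theorems.GenusKolyvaginAtTwoPowDvdShaCardAtTwoRTSelmerLayerOneNormCore
import Summits.BirchSwinnertonDyer.BirchSwinnertonDyer.Theorems.GenusKolyvaginAtTwoPowDvdShaCardAtTwoRTNonPhantomPowHabitat
import Summits.BirchSwinnertonDyer.BirchSwinnertonDyer.Theorems.GenusKolyvaginAtTwoPowDvdShaCardAtTwoRTTwinShaLaddersOfProp52Div
import HarnessLib

/-!
# Route `GenusKolyvaginAtTwo`, cruxes L_T `PowDvdShaCardAtTwoRT` (stmt-BirchSwinnertonDyer-23659) / U_T `ShaCardDvdPowAtTwoRT` (stmt-23658) —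
# KOLYVAGIN'S FIRST SELMER ANNIHILATION AT `2`, NORM-SHARP, FRAME INSTANTIATED: on L_T's frame, modulo Q2 only,
# `2^(M₀) • (s + w • τ_* s) = 0` for EVERY `s ∈ Sel_{2^M}(E/K)`, `M ≥ M₀ + 1` (no lost bit)

Seat `bsd-line-gk2-p5` g28 (cell `bsd-f1-sign2`), `--supports stmt-BirchSwinnertonDyer-23659` (helper; closes nothing).  THEOREMS ONLY
(no definition, no named fact, no `sorry`).  Sequel of `…RTSelmerLayerOneNormCore` (p745283: `selmerLayerOne_core_norm` with the displayed
NORM slot `hP7n`, and `normLaw_sharp_at_two` = that slot discharged from gk2-p3 g25's p741749).  BSD is NOT proved by any of this; neither is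
L_T, U_T, nor any stub.

* §3 `selmerLayerOneNormAtTwo` (frame BUILT inside as in the LEAD's `exactSwapAtTwo`, with P8 `dualTransported_eq_of_hybrid`, P4
  `JET.localization_kolyvaginClass_mem_globalTransverse_two`, the NORM slot `normLaw_sharp_at_two` and T2 (`t = 0`, odd Tamagawa) discharged
  inline; `z ∈ selmerGroup (W⁄K) (2^M)`):
  `addOrderOf c_M(1) = 2^g` ⟹ **`2^(M−g) • (z + w • τ_* z) = 0`**; `selmerLayerOneNormAtTwo_of_divisibility` (`2^(M₀) ∥ y_K` ⟹ `g = M − M₀` by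
  `addOrderOf_kolyvaginClass_two_eq_pow_sub_single` ⟹ **`2^(M₀) • (s + w • τ_* s) = 0`**, `M ≥ M₀ + 1`); **`selmerLayerOneNormAtTwo_onHabitat`**
  ((NPh) discharged by the frame's odd multiplicative prime, gk2-p3 `NonPhantomPow.nonPhantomAtTwo_of_hasMultiplicativeReductionAt` p714902;
  binders in L_T's own currency) — gk2-p3's U_T memo §2 law «`2^(M₀)·(1 + wτ)·Sel_(2^M)(E/K) = 0`», the exact analogue at `2` of
  Kolyvagin's `p^(M₀)·Sel^(−ε) = 0` at odd `p`, modulo Q2 (an antecedent of L_T / U_T) ONLY.  One bit sharper than the eigen form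
  `selmerLayerOneAtTwo_norm_onHabitat` (p743346).

References: [GrossLMS1991] §8 Prop. 8.2, §10; [McCallumLMS1991] §5 (13), Lemma 5.3, Thm. 5.4; [Kolyvagin1991MathAnn] Thm. 2.1, §2 Thm. 2.2;
[KolyvaginEulerSystems1990] Thm. A.
-/

set_option autoImplicit false
set_option linter.dupNamespace false

noncomputable section

open scoped Classical Pointwise
open Function NumberField IsDedekindDomain WeierstrassCurve Field
open Literature.NumberTheory.EllipticCurves Literature.NumberTheory.GaloisRepresentations
open Literature.NumberTheory.EllipticCurves.Jetchev2008 Literature.NumberTheory.EllipticCurves.ModularForms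
open Literature.NumberTheory.GaloisCohomology
open Literature.NumberTheory.GaloisRepresentations.DiscreteGaloisModule (localTatePairingZMod
  tateDual transverseSubgroup SelmerStructure)
open Literature.NumberTheory.Automorphic
open Summit.BirchSwinnertonDyer.Rank1Residual
open Summit.BirchSwinnertonDyer.Rank1Residual.JET.SelmerVocabulary
open Summit.BirchSwinnertonDyer.Rank1Residual.JET.GlobalDuality
open Summit.BirchSwinnertonDyer.BirchSwinnertonDyer.Theses.GenusKolyvaginAtTwo (KolyvaginRelationAtTwo)
open Summit.BirchSwinnertonDyer.BirchSwinnertonDyer.Theorems.KolyvaginLowerBoundAtTwo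

namespace Summit.BirchSwinnertonDyer.BirchSwinnertonDyer.Theorems.GenusExact.PlusDescent

open Summit.BirchSwinnertonDyer.Rank1Residual.X11b.Relaxation

/-! ## §3 The frame instantiated (hybrid discharge inlined); the `M₀`-currency; (NPh) discharged on the (D-NPh) habitat -/

section Instantiated

variable {K : Type} [Field K] [NumberField K] (W : WeierstrassCurve ℚ) [W.IsElliptic] [W.IsGloballyMinimal] [NeZero (W.conductorNorm ℤ)]

/-- **NORM-SHARP LAYER 1, frame instantiated** (UNCONDITIONAL up to Q2 and (NPh_{M+k})): on L_T's habitat, for a conductor-`1` datum `d₁`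
with `addOrderOf c_M(1) = 2^g` (`g ≥ 1`) and EVERY `z ∈ Sel_{2^M}(E/K)`: **`2^(M−g) • (z + w • τ_* z) = 0`** (`w = W.rootNumber`).
[cite: McCallumLMS1991, §5 (13), Lemma 5.3] [cite: GrossLMS1991, §8 Prop. 8.2, §10] [cite: Kolyvagin1991MathAnn, §2 Thm. 2.2] -/
theorem selmerLayerOneNormAtTwo (hCM : ¬ W.HasCM) (hΔ : W.Δ < 0) (hTam : Odd W.tamagawaProduct)
    (hsur : ∀ m : ℕ, W.HasSurjectiveModNGaloisRep (2 ^ m : ℕ)) (hK : IsImaginaryQuadratic K)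
    (hodd : Odd (NumberField.discr K)) (hne3 : NumberField.discr K ≠ -3)
    (hns : ¬ IsSquare ((NumberField.discr K : ℚ) * -|W.Δ|))
    (hHN : SatisfiesHeegnerHypothesis (W.conductorNorm ℤ) K) (τ : K ≃ₐ[ℚ] K) (hτ1 : τ ≠ 1)
    (Dt : ModularParametrizationData W (W.conductorNorm ℤ)) (β : ℤ) (ι : K →+* ℂ)
    (hQ2 : KolyvaginRelationAtTwo)
    {M k g : ℕ} (d₁ : KolyvaginHeegnerData Dt β ι 1)
    (hM : 1 ≤ M) (hk : 1 ≤ k) (hg : 1 ≤ g) (hord : addOrderOf (d₁.kolyvaginClass Nat.prime_two M) = 2 ^ g)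
    (hNPh : ∀ z : galH1Torsion (W.baseChange K) ((2 ^ (M + k) : ℕ) : ℤ),
      (∀ ρ ∈ torsionFixing (W.baseChange K) ((2 ^ (M + k) : ℕ) : ℤ),
        h1Eval (W.baseChange K) ((2 ^ (M + k) : ℕ) : ℤ) z ρ = 0) →
      (∀ w : HeightOneSpectrum (𝓞 K), ((2 * W.conductorNorm ℤ : ℕ) : 𝓞 K) ∈ w.asIdeal →
        z ∈ selmerLocalKer (W.baseChange K) (w.adicCompletion K) ((2 ^ (M + k) : ℕ) : ℤ)) → z = 0)
    (z : galH1Torsion (W.baseChange K) ((2 ^ M : ℕ) : ℤ))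
    (hz : z ∈ selmerGroup (W.baseChange K) ((2 ^ M : ℕ) : ℤ)) :
    ((2 ^ (M - g) : ℕ) : ℤ) • (z + W.rootNumber • conjAct W τ ((2 ^ M : ℕ) : ℤ) z) = 0 := by
  classical
  haveI : Fact (Nat.Prime 2) := ⟨Nat.prime_two⟩
  haveI : ∀ j : ℕ, NumberField (ringClassField K ι j) := JET.numberField_ringClassField K hK ι
  haveI : (W.baseChange K).IsElliptic := by rw [baseChange]; infer_instance
  haveI hNZ : ∀ M : ℕ, NeZero (2 ^ M) := fun M ↦ ⟨pow_ne_zero M two_ne_zero⟩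
  haveI : ∀ M : ℕ, Finite (geomTorsion (W.baseChange K) ((2 ^ M : ℕ) : ℤ)) := fun M ↦
    finite_geomTorsion_of_neZero (W.baseChange K) (2 ^ M)
  have hinv : ∀ M : ℕ, ∃ inv : LocalInvariants K (2 ^ M), inv.IsPerfect ∧ inv.SumLocalTermEqZero ∧
      inv.UnramifiedOrthogonal ∧ inv.SelmerComplement ∧ ∀ σ : K ≃ₐ[ℚ] K, inv.IsConjCompatible σ :=
    fun M ↦ InputsPoitouTateSelmer.poitouTate_selmerStructure_duality_conj_holds K (2 ^ M)
  choose inv hperf hvan hUO hSC hconj using hinv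
  have hweil := fun M : ℕ ↦ exists_weilDatum_liftAut_two_pow (K := K) W τ M
  choose e hμ hadd₁ hadd₂ hgal halt hnondeg hτe using hweil
  have hhyb := fun M : ℕ ↦ exists_hybridTransverseFamily (K := K) W ι M
  choose 𝒯 hTko hTku using hhyb
  have hne4 : NumberField.discr K ≠ -4 := fun h ↦ by
    rw [h] at hodd; have := Int.odd_iff.mp hodd; omega
  have hD : NumberField.discr K < -4 := IsImaginaryQuadratic.discr_lt_neg_four_of_odd hK hodd hne3
  have hinj : ∀ (M : ℕ) (v : HeightOneSpectrum (𝓞 K)), Injective (inv M (Sum.inr v)) :=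
    fun M v ↦ ((hperf M) v).1.injective
  -- P8: self-duality of the hybrid structure at every finite place
  have h𝒯sd : ∀ (M c : ℕ), ∀ v ∈ placesDividing K c,
      (inv M).dualTransported (𝒯 M) (weilDualIntertwining (W.baseChange K) (2 ^ M) (e M) (hμ M) (hadd₁ M)
        (hadd₂ M) (hgal M)) (Sum.inr v) = 𝒯 M (Sum.inr v) := fun M c ↦
    dualTransported_eq_of_hybrid W M (e M) (hμ M) (hadd₁ M) (hadd₂ M) (hgal M) (halt M) (hnondeg M) (inv M)
      (𝒯 M) hK hD ι (hinj M) (fun v ↦ by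
        by_cases h : ∃ q : ℕ, Zhang2014.IsKolyvaginPrime (W.conductorNorm ℤ) W K 2 q ∧
            M + 1 ≤ Zhang2014.kolyvaginIndex W 2 q ∧ (q : 𝓞 K) ∈ v.asIdeal
        · obtain ⟨q, hq, hMq, hqv⟩ := h
          exact Or.inl ⟨q, hq, hMq, hqv, hTko M v q hq hMq hqv⟩
        · exact Or.inr (hTku M v h)) c
  -- P4: transversality at the primes of the conductor — (V44) at margin one, unconditional at 2
  have hP4 : ∀ (M c : ℕ) (dat : KolyvaginHeegnerData Dt β ι c),
      KolyvaginDescent.KolSupp (Zhang2014.IsKolyvaginPrime (W.conductorNorm ℤ) W K 2) c → 1 ≤ M →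
      (∀ q ∈ c.primeFactors, M + 1 ≤ Zhang2014.kolyvaginIndex W 2 q) →
      ∀ w ∈ placesDividing K c,
        galoisCohomology.localization ((W.baseChange K).torsionGaloisModule ((2 ^ M : ℕ) : ℤ)) (Sum.inr w) 1
          (dat.kolyvaginClass Nat.prime_two M) ∈ 𝒯 M (Sum.inr w) := by
    intro M c dat hc _ hcM w hw
    obtain ⟨𝒯g, h𝒯g, -⟩ := JET.Walk.exists_globalTransverseFamily W ι ((2 ^ M : ℕ) : ℤ)
    have hmem := JET.localization_kolyvaginClass_mem_globalTransverse_two W hK hD Dt β ι M h𝒯g dat hc hcM w hw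
    obtain ⟨q, hqc, hqw⟩ := (natCast_mem_iff_exists_primeFactor_mem hc.1.ne_zero w).mp
      ((mem_placesDividing_iff_natCast_mem hc.1.ne_zero w).mp hw)
    rw [hTko M w q (hc.2 q hqc) (hcM q hqc) hqw, ← JET.Walk.globalTransverse_eq_of_natCast_mem h𝒯g w
      (Nat.prime_of_mem_primeFactors hqc) hqw]
    exact hmem
  -- the NORM slot: gk2-p3 g25's sharp annihilation law, bridged (`normLaw_sharp_at_two`)
  have hP7n := normLaw_sharp_at_two (W := W) (τ := τ) (e := e) (hμ := hμ) (hadd₁ := hadd₁)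
    (hadd₂ := hadd₂) (hgal := hgal) (halt := halt) (hnondeg := hnondeg) (hτe := hτe) (inv := inv) (hK := hK) (hΔ := hΔ)
    (hτ1 := hτ1) (hperf := hperf) (hinvc := fun M ↦ hconj M τ)
  -- T2 with t = 0: Gross 6.2(1) / McCallum 4.3 at 2 on the odd-Tamagawa habitat
  have hT2 := pow_zero_zsmul_kolyvaginClass_two_mem_selmerLocalKer_of_odd_tamagawaProduct W hsur hTam hK hne3 hne4 hHN Dt β ι
  exact selmerLayerOne_core_norm (W := W) (τ := τ) (Dt := Dt) (β := β) (ι := ι) (e := e) (hμ := hμ) (hadd₁ := hadd₁)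
    (hadd₂ := hadd₂) (hgal := hgal) (halt := halt) (hnondeg := hnondeg) (inv := inv) (𝒯 := 𝒯) (hCM := hCM) (hΔ := hΔ)
    (hsur := hsur) (hK := hK) (hodd := hodd) (hne3 := hne3) (hns := hns) (hHN := hHN) (hτ1 := hτ1) (hperf := hperf)
    (hvan := hvan) (h𝒯sd := h𝒯sd) (hP4 := hP4) (hP7n := hP7n) (hQ2 := hQ2) (hT2 := hT2) d₁ hM hk hg hord hNPh z hz

/-- **NORM-SHARP LAYER 1 in L_T's `M₀`-currency**: `2^(M₀) ∥ y_K` in `E(K[1])` ⟹ `g = M − M₀`, so for every level `M ≥ M₀ + 1` and EVERY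
`s ∈ Sel_{2^M}(E/K)`: **`2^(M₀) • (s + w • τ_* s) = 0`** (modulo Q2 + (NPh_{M+k})) — gk2-p3's U_T memo §2 law «`2^(M₀)·(1 + wτ)·Sel = 0`».
[cite: McCallumLMS1991, §5 (13), Thm. 5.4] [cite: GrossLMS1991, §10] -/
theorem selmerLayerOneNormAtTwo_of_divisibility (hCM : ¬ W.HasCM) (hΔ : W.Δ < 0) (hTam : Odd W.tamagawaProduct)
    (hsur : ∀ m : ℕ, W.HasSurjectiveModNGaloisRep (2 ^ m : ℕ)) (hK : IsImaginaryQuadratic K)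
    (hodd : Odd (NumberField.discr K)) (hne3 : NumberField.discr K ≠ -3)
    (hns : ¬ IsSquare ((NumberField.discr K : ℚ) * -|W.Δ|))
    (hHN : SatisfiesHeegnerHypothesis (W.conductorNorm ℤ) K) (τ : K ≃ₐ[ℚ] K) (hτ1 : τ ≠ 1)
    (Dt : ModularParametrizationData W (W.conductorNorm ℤ)) (β : ℤ) (ι : K →+* ℂ)
    (hQ2 : KolyvaginRelationAtTwo)
    (d₁ : KolyvaginHeegnerData Dt β ι 1) {M₀ M k : ℕ}
    (hdiv : ∃ Q : (W.baseChange (ringClassField K ι 1)).toAffine.Point, ((2 ^ M₀ : ℕ) : ℤ) • Q = d₁.derivedPoint)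
    (hndiv : ¬ ∃ Q : (W.baseChange (ringClassField K ι 1)).toAffine.Point, ((2 ^ (M₀ + 1) : ℕ) : ℤ) • Q = d₁.derivedPoint)
    (hM : M₀ + 1 ≤ M) (hk : 1 ≤ k)
    (hNPh : ∀ z : galH1Torsion (W.baseChange K) ((2 ^ (M + k) : ℕ) : ℤ),
      (∀ ρ ∈ torsionFixing (W.baseChange K) ((2 ^ (M + k) : ℕ) : ℤ),
        h1Eval (W.baseChange K) ((2 ^ (M + k) : ℕ) : ℤ) z ρ = 0) →
      (∀ w : HeightOneSpectrum (𝓞 K), ((2 * W.conductorNorm ℤ : ℕ) : 𝓞 K) ∈ w.asIdeal →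
        z ∈ selmerLocalKer (W.baseChange K) (w.adicCompletion K) ((2 ^ (M + k) : ℕ) : ℤ)) → z = 0)
    (s : galH1Torsion (W.baseChange K) ((2 ^ M : ℕ) : ℤ))
    (hs : s ∈ selmerGroup (W.baseChange K) ((2 ^ M : ℕ) : ℤ)) :
    ((2 ^ M₀ : ℕ) : ℤ) • (s + W.rootNumber • conjAct W τ ((2 ^ M : ℕ) : ℤ) s) = 0 := by
  have hsur1 : W.HasSurjectiveModNGaloisRep ((2 : ℤ) ^ 1) := by exact_mod_cast hsur 1
  have hord : addOrderOf (d₁.kolyvaginClass Nat.prime_two M) = 2 ^ (M - M₀) :=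
    addOrderOf_kolyvaginClass_two_eq_pow_sub_single (Dt := Dt) (β := β) (ι := ι) hK hodd hne3 hHN hsur1 squarefree_one
      (fun q hq ↦ by simp at hq) d₁ (by omega) hdiv hndiv
  have h := selmerLayerOneNormAtTwo W hCM hΔ hTam hsur hK hodd hne3 hns hHN τ hτ1 Dt β ι hQ2 d₁ (g := M - M₀) (by omega) hk
    (by omega) hord hNPh s hs
  rwa [show M - (M - M₀) = M₀ by omega] at h

/-- **NORM-SHARP LAYER 1 ON L_T's FRAME, modulo Q2 ONLY** ((NPh) DISCHARGED by the frame's odd multiplicative prime, gk2-p3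
`NonPhantomPow.nonPhantomAtTwo_of_hasMultiplicativeReductionAt` p714902; binders in L_T's own currency): for every level `M ≥ M₀ + 1` and EVERY
`s ∈ Sel_{2^M}(E/K)`, **`2^(M₀) • (s + w • τ_* s) = 0`** — Kolyvagin's first annihilation at `2` with NO lost bit (the exact analogue of
`p^(M₀)·Sel^(−ε) = 0` at odd `p`).  [cite: GrossLMS1991, §10] [cite: KolyvaginEulerSystems1990, Thm. A] [cite: McCallumLMS1991, §5 Thm. 5.4] -/
theorem selmerLayerOneNormAtTwo_onHabitat (hQ2 : KolyvaginRelationAtTwo)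
    (hCM : ¬ W.HasCM) (hTam : Odd W.tamagawaProduct)
    (v : HeightOneSpectrum (𝓞 ℚ)) (h2v : ((2 : ℕ) : 𝓞 ℚ) ∉ v.asIdeal)
    (hNv : ((W.conductorNorm ℤ : ℕ) : 𝓞 ℚ) ∈ v.asIdeal) (hmult : W.HasMultiplicativeReductionAt v) (hΔ : W.Δ < 0)
    (hK : IsImaginaryQuadratic K) (hodd : Odd (NumberField.discr K)) (hne3 : NumberField.discr K ≠ -3)
    (hHN : SatisfiesHeegnerHypothesis (W.conductorNorm ℤ) K)
    (hns : ¬ IsSquare ((NumberField.discr K : ℚ) * -|W.Δ|)) (hns₂ : ¬ IsSquare ((NumberField.discr K : ℚ) * (-(2 * |W.Δ|))))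
    (hρ : ∀ n : ℕ, 0 < n → W.HasSurjectiveModNGaloisRep ((2 : ℤ) ^ n))
    (Dt : ModularParametrizationData W (W.conductorNorm ℤ)) (β : ℤ) (ι : K →+* ℂ)
    (d₁ : KolyvaginHeegnerData Dt β ι 1) (M₀ : ℕ)
    (hdiv : ∃ Q : (W.baseChange (ringClassField K ι 1)).toAffine.Point, ((2 ^ M₀ : ℕ) : ℤ) • Q = d₁.derivedPoint)
    (hndiv : ¬ ∃ Q : (W.baseChange (ringClassField K ι 1)).toAffine.Point, ((2 ^ (M₀ + 1) : ℕ) : ℤ) • Q = d₁.derivedPoint)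
    (τ : K ≃ₐ[ℚ] K) (hτ1 : τ ≠ 1) {M : ℕ} (hM : M₀ + 1 ≤ M)
    (s : galH1Torsion (W.baseChange K) ((2 ^ M : ℕ) : ℤ))
    (hs : s ∈ selmerGroup (W.baseChange K) ((2 ^ M : ℕ) : ℤ)) :
    ((2 ^ M₀ : ℕ) : ℤ) • (s + W.rootNumber • conjAct W τ ((2 ^ M : ℕ) : ℤ) s) = 0 := by
  -- currency of the big-image binder (`m = 0`: `E[1] = 0`, so `ρ̄_{E,1}` is onto)
  have hsur : ∀ m : ℕ, W.HasSurjectiveModNGaloisRep (2 ^ m : ℕ) := by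
    intro m
    rcases Nat.eq_zero_or_pos m with rfl | hm
    · have h1 : W.HasSurjectiveModNGaloisRep 1 := by
        haveI : Subsingleton (geomTorsion W (1 : ℤ)) := ⟨fun a b ↦ by
          have ha := AddSubgroup.torsionBy.nsmul_iff.mp a.2
          have hb := AddSubgroup.torsionBy.nsmul_iff.mp b.2
          simp only [one_smul] at ha hb
          exact Subtype.ext (ha.trans hb.symm)⟩
        intro y
        exact ⟨1, Multiplicative.toAdd.injective (AddEquiv.ext fun a ↦ Subsingleton.elim _ _)⟩
      simpa using h1
    · have h := hρ m hm
      simpa [Nat.cast_pow] using h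
  -- (NPh) at level `2^(M+1)` from the odd multiplicative prime
  have hNPh := NonPhantomPow.nonPhantomAtTwo_of_hasMultiplicativeReductionAt W hTam hρ hK hodd hns hns₂
    (NeZero.ne (W.conductorNorm ℤ)) hHN h2v hNv hmult (M + 1) (by omega)
  exact selmerLayerOneNormAtTwo_of_divisibility W hCM hΔ hTam hsur hK hodd hne3 hns hHN τ hτ1 Dt β ι hQ2 d₁ hdiv hndiv hM le_rfl
    hNPh s hs

end Instantiated

end Summit.BirchSwinnertonDyer.BirchSwinnertonDyer.Theorems.GenusExact.PlusDescent

end
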